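import Literature.Geometry.Kaehler.ComplexTorusPolarizationProductInequality
import Literature.Geometry.Kaehler.ComplexTorusPolarizedDecompositionExponent
import HarnessLib

/-!
# Debarre 1996, Corollaire 4 in its printed shape: `(X₁·X₂)² · deg η ≤ deg η|X₁ · deg η|X₂`

Layer `Literature/Geometry/Kaehler`, namespace `Literature.Geometry.Kaehler.ComplexTorus`; lane `lit-hodgefound`
(Track 2 foundations library), seat p16, row g14-#3 FILE 2 (rider to
`ComplexTorusPolarizationProductInequality`). THEOREMS ONLY: no definition, no named fact, net debt `0`.

## Source, VERBATIM

O. Debarre, *Polarisations sur les variétés abéliennes produits*, C. R. Acad. Sci. Paris **323** (1996),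
p. 634: «Si `X₁` et `X₂` sont des sous-variétés abéliennes d'une variété abélienne `X`, on définit `X₁·X₂` comme
le degré de l'application `X₁ × X₂ → X` qui à `(x₁, x₂)` associe `x₁ + x₂`. C'est aussi le degré du produit
d'intersection des classes de `X₁` et `X₂` dans l'anneau de Chow de `X`. **Corollaire 4.** Soient `X` une
variété abélienne, et `X₁` et `X₂` des sous-variétés abéliennes de `X`. Si `L` est un fibré en droites ample
sur `X`, on a `(X₁·X₂) h⁰(X, L) ≤ h⁰(X₁, L|X₁) h⁰(X₂, L|X₂)`. On peut supposer `d = X₁·X₂` non nul, de sorte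
que l'application `σ : X₁ × X₂ → X` est une isogénie de degré `d`. Le théorème donne
`h⁰(X₁ × X₂, σ*L) ≤ h⁰(X₁, L|X₁) h⁰(X₂, L|X₂)`. Ceci montre le corollaire puisque `h⁰(X₁ × X₂, σ*L) = d h⁰(X, L)`.»

## Contents (all PROVED; squared, `h⁰(L)² = polarizationDegree` by the tree's
`IsRiemannForm.sq_h0_lineBundleAH_eq_polarizationDegree`)

For complex lattice subspaces `V`, `W` with `Λ ⊗ ℝ = V ⊕ W` (complementary abelian subvarieties `X₁`, `X₂`,
so that `σ` is an isogeny; `d = X₁·X₂ = #(X₁ ∩ X₂) = Nat.card (subtorus Φ V ⊓ subtorus Φ W)`, the tree's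
`natCard_ker_addition`):
* `subRank_add_subRank_of_isCompl` (`rk Λ₁ + rk Λ₂ = rk Λ`);
* `det_latticeGram_pullbackForm_additionRep` (`det E' = det(P□)² · det E` for the square reindexing `P□` of
  `P = (C₁ | C₂)`); **`polarizationDegree_pullbackForm_additionRep`**: «`h⁰(X₁ × X₂, σ*L) = d h⁰(X, L)`» squared,
  `polarizationDegree (X₁ × X₂, σ*η) = d² · polarizationDegree (X, η)`;
* **`debarre1996_corollaire_4`**: `d² · polarizationDegree (X, η) ≤ polarizationDegree (X₁, η|X₁) ·
  polarizationDegree (X₂, η|X₂)`, **`debarre1996_corollaire_4_eq_iff`** (equality iff `η(ΦV, ΦW) = 0`);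
* **`debarre1996_theoreme_3_of_sup_subLattice_eq_top`**: Théorème 3 for an internal product `X = X₁ × X₂`
  (`Λ = Λ₁ ⊕ Λ₂`, `d = 1`): `polarizationDegree (X, η) ≤ polarizationDegree (X₁, η|X₁) · polarizationDegree (X₂, η|X₂)`.

## References

* [Debarre1996PolarisationsProduits] O. Debarre, C. R. Acad. Sci. Paris Sér. I **323** (1996) 631–635, § 2
  Corollaire 4 and its proof (`paper:url-cf01ad14f74f` p. 4).
* [Lange2023AbelianVarietiesComplex] H. Lange, *Abelian Varieties over the Complex Numbers*, Springer 2023,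
  §1.1.2 Prop. 1.1.13 (`deg ρ(A) = |det A|`), §2.4.4 Prop. 2.4.29 (`ker μ ≃ Y ∩ Z`).
-/

noncomputable section

open Module Function Submodule Complex Set Matrix

namespace Literature.Geometry.Kaehler

namespace ComplexTorus

variable {ι : Type*} {E : Type*} [NormedAddCommGroup E] [NormedSpace ℂ E] [Fintype ι] [DecidableEq ι]
  {Φ : (ι → ℝ) ≃L[ℝ] E} {η : E [⋀^Fin 2]→L[ℝ] ℝ} {V W : Submodule ℝ (ι → ℝ)}

omit [DecidableEq ι] in
/-- **`rk Λ₁ + rk Λ₂ = rk Λ`** for complementary lattice subspaces `Λ ⊗ ℝ = V ⊕ W`.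
[cite: Lange2023AbelianVarietiesComplex, §2.4.4 Cor. 2.4.24 («`dim Y + dim Z = dim X`»), p. 123] -/
theorem subRank_add_subRank_of_isCompl (hV : IsLatticeSubspace V) (hW : IsLatticeSubspace W)
    (hVW : IsCompl V W) : subRank V + subRank W = Fintype.card ι := by
  rw [← finrank_eq_subRank hV, ← finrank_eq_subRank hW, ← Module.finrank_fintype_fun_eq_card (R := ℝ) (η := ι)]
  have h := Submodule.finrank_sup_add_finrank_inf_eq V W
  rw [hVW.sup_eq_top, hVW.inf_eq_bot, finrank_bot, add_zero, finrank_top] at h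
  exact h.symm

omit [DecidableEq ι] in
/-- The index set `Fin r₁ ⊔ Fin r₂` of the lattice of `X₁ × X₂` has the cardinality of `ι` when `Λ ⊗ ℝ = V ⊕ W`.
[cite: Lange2023AbelianVarietiesComplex, §2.4.4 Cor. 2.4.24, p. 123] -/
theorem card_sum_fin_subRank_eq (hV : IsLatticeSubspace V) (hW : IsLatticeSubspace W) (hVW : IsCompl V W) :
    Fintype.card (Fin (subRank V) ⊕ Fin (subRank W)) = Fintype.card ι := by
  rw [Fintype.card_sum, Fintype.card_fin, Fintype.card_fin, subRank_add_subRank_of_isCompl hV hW hVW]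

/-- An integer matrix and its real form have the same determinant. [folklore] -/
private theorem det_map_intCast {κ : Type*} [Fintype κ] [DecidableEq κ] (B : Matrix κ κ ℤ) :
    (B.map (Int.cast : ℤ → ℝ)).det = (B.det : ℝ) := by
  rw [show B.map (Int.cast : ℤ → ℝ) = (Int.castRingHom ℝ).mapMatrix B from rfl, ← RingHom.map_det, eq_intCast]

/-- **`det E' = det(P□)² · det E`**: the Gram matrix `E' = ᵗP E P` of `σ*η` on `Λ₁ ⊕ Λ₂` and the square
reindexing `P□ = P.submatrix σ id` of the rational representation `P = (C₁ | C₂)` of `σ` along any bijection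
`σ : Fin r₁ ⊔ Fin r₂ ≃ ι`. [cite: Lange2023AbelianVarietiesComplex, §1.1.2 Prop. 1.1.13 (proof of (c)), p. 22]
[cite: Debarre1996PolarisationsProduits, Corollaire 4 (proof: «`h⁰(X₁ × X₂, σ*L) = d h⁰(X, L)`»)] -/
theorem det_latticeGram_pullbackForm_additionRep (hV : IsLatticeSubspace V) (hVc : IsComplexSubspace Φ V)
    (hW : IsLatticeSubspace W) (hWc : IsComplexSubspace Φ W) (σ : Fin (subRank V) ⊕ Fin (subRank W) ≃ ι) :
    (latticeGram (prodPeriod (subtorusPeriod Φ V hV hVc) (subtorusPeriod Φ W hW hWc))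
        (pullbackForm (additionRep Φ V W) η)).det =
      (((additionMatrix V W).submatrix σ id).det : ℝ) ^ 2 * (latticeGram Φ η).det := by
  set P := (additionMatrix V W).map (Int.cast : ℤ → ℝ) with hP
  set G := latticeGram Φ η with hG
  have hB : ((additionMatrix V W).submatrix σ id).map (Int.cast : ℤ → ℝ) = P.submatrix σ id := by
    rw [hP, submatrix_map]
  have h : (P.submatrix σ id)ᵀ * G.submatrix σ σ * P.submatrix σ id = Pᵀ * G * P := by
    rw [transpose_submatrix, submatrix_mul_equiv, submatrix_mul_equiv, submatrix_id_id]
  rw [latticeGram_pullbackForm_additionRep hV hVc hW hWc, ← hP, ← hG, ← h, det_mul, det_mul, det_transpose,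
    det_submatrix_equiv_self, ← hB, det_map_intCast]
  ring

/-- **«`h⁰(X₁ × X₂, σ*L) = d h⁰(X, L)`», squared: `polarizationDegree (X₁ × X₂, σ*η) = d² · polarizationDegree (X, η)`**
with `d = deg σ = #(X₁ ∩ X₂)` (`Nat.card` of `subtorus Φ V ⊓ subtorus Φ W`), for complementary `V`, `W`.
[cite: Debarre1996PolarisationsProduits, Corollaire 4 (proof)] [cite: Lange2023AbelianVarietiesComplex, §1.1.2 Prop. 1.1.13 and §2.4.4 Prop. 2.4.29, pp. 21, 125] -/
theorem polarizationDegree_pullbackForm_additionRep (hV : IsLatticeSubspace V) (hVc : IsComplexSubspace Φ V)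
    (hW : IsLatticeSubspace W) (hWc : IsComplexSubspace Φ W) (hVW : IsCompl V W) :
    polarizationDegree (prodPeriod (subtorusPeriod Φ V hV hVc) (subtorusPeriod Φ W hW hWc))
        (pullbackForm (additionRep Φ V W) η) =
      (Nat.card ↥(subtorus Φ V ⊓ subtorus Φ W) : ℝ) ^ 2 * polarizationDegree Φ η := by
  obtain ⟨σ⟩ : Nonempty (Fin (subRank V) ⊕ Fin (subRank W) ≃ ι) :=
    Fintype.card_eq.1 (card_sum_fin_subRank_eq hV hW hVW)
  rw [polarizationDegree_eq_det, polarizationDegree_eq_det,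
    det_latticeGram_pullbackForm_additionRep hV hVc hW hWc σ, ← natCard_ker_addition Φ hV hVc hW hWc,
    natCard_ker_mapMatrixHom_eq_natAbs_det_submatrix _ Φ (additionMatrix V W) σ, Nat.cast_natAbs, Int.cast_abs,
    sq_abs]

/-- **Debarre 1996, Corollaire 4 (squared, in the Riemann-form dictionary): «`(X₁·X₂) h⁰(X, L) ≤
h⁰(X₁, L|X₁) h⁰(X₂, L|X₂)`»** — for complementary abelian subvarieties `X₁`, `X₂` (`Λ ⊗ ℝ = V ⊕ W`) of the
polarised torus `(X, η)`, with `X₁·X₂ = #(X₁ ∩ X₂)` the degree of the addition isogeny: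
`(X₁·X₂)² · polarizationDegree (X, η) ≤ polarizationDegree (X₁, η|X₁) · polarizationDegree (X₂, η|X₂)`.
[cite: Debarre1996PolarisationsProduits, Corollaire 4] [cite: HornJohnson2013, Thm 7.8.5 (Fischer's inequality)] -/
theorem debarre1996_corollaire_4 (hη : IsRiemannForm Φ η) (hV : IsLatticeSubspace V)
    (hVc : IsComplexSubspace Φ V) (hW : IsLatticeSubspace W) (hWc : IsComplexSubspace Φ W)
    (hVW : IsCompl V W) :
    (Nat.card ↥(subtorus Φ V ⊓ subtorus Φ W) : ℝ) ^ 2 * polarizationDegree Φ η ≤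
      polarizationDegree (subtorusPeriod Φ V hV hVc) (pullbackForm (cxSpan Φ V).subtypeL η) *
        polarizationDegree (subtorusPeriod Φ W hW hWc) (pullbackForm (cxSpan Φ W).subtypeL η) := by
  rw [← polarizationDegree_pullbackForm_additionRep hV hVc hW hWc hVW]
  exact debarre1996_theoreme_3 hη hV hVc hW hWc hVW.disjoint

/-- **Corollaire 4, equality case** (from Théorème 3's): equality iff `η(ΦV, ΦW) = 0`.
[cite: Debarre1996PolarisationsProduits, Théorème 3 and Corollaire 4] -/
theorem debarre1996_corollaire_4_eq_iff (hη : IsRiemannForm Φ η) (hV : IsLatticeSubspace V)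
    (hVc : IsComplexSubspace Φ V) (hW : IsLatticeSubspace W) (hWc : IsComplexSubspace Φ W)
    (hVW : IsCompl V W) :
    (Nat.card ↥(subtorus Φ V ⊓ subtorus Φ W) : ℝ) ^ 2 * polarizationDegree Φ η =
      polarizationDegree (subtorusPeriod Φ V hV hVc) (pullbackForm (cxSpan Φ V).subtypeL η) *
        polarizationDegree (subtorusPeriod Φ W hW hWc) (pullbackForm (cxSpan Φ W).subtypeL η) ↔
      ∀ v ∈ V, ∀ w ∈ W, η ![Φ v, Φ w] = 0 := by
  rw [← polarizationDegree_pullbackForm_additionRep hV hVc hW hWc hVW]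
  exact debarre1996_theoreme_3_eq_iff hη hV hVc hW hWc hVW.disjoint

/-- **Théorème 3 for an internal product `X = X₁ × X₂`** (`Λ ⊗ ℝ = V ⊕ W` AND `Λ = Λ₁ ⊕ Λ₂`, i.e. `X₁ ∩ X₂ = 0`,
`X₁·X₂ = 1`): `polarizationDegree (X, η) ≤ polarizationDegree (X₁, η|X₁) · polarizationDegree (X₂, η|X₂)`, for ANY
polarisation `η` of `X` — «`h⁰(X, L) ≤ h⁰(X₁, L|X₁) h⁰(X₂, L|X₂)`» squared.
[cite: Debarre1996PolarisationsProduits, Théorème 3] -/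
theorem debarre1996_theoreme_3_of_sup_subLattice_eq_top (hη : IsRiemannForm Φ η) (hV : IsLatticeSubspace V)
    (hVc : IsComplexSubspace Φ V) (hW : IsLatticeSubspace W) (hWc : IsComplexSubspace Φ W)
    (hVW : IsCompl V W) (hsup : subLattice V ⊔ subLattice W = ⊤) :
    polarizationDegree Φ η ≤
      polarizationDegree (subtorusPeriod Φ V hV hVc) (pullbackForm (cxSpan Φ V).subtypeL η) *
        polarizationDegree (subtorusPeriod Φ W hW hWc) (pullbackForm (cxSpan Φ W).subtypeL η) := by
  have h := debarre1996_corollaire_4 hη hV hVc hW hWc hVW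
  have hone : Nat.card ↥(subtorus Φ V ⊓ subtorus Φ W) = 1 := by
    rw [(sup_subLattice_eq_top_iff_inf_subtorus_eq_bot (Φ := Φ) hVW).1 hsup]
    simp
  rw [hone, Nat.cast_one, one_pow, one_mul] at h
  exact h

end ComplexTorus

end Literature.Geometry.Kaehler

end
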